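import Summits.ResolutionOfSingularities.ResolutionOfSingularities.Theorems.CompanionCutCells
import Summits.ResolutionOfSingularities.ResolutionOfSingularities.Theorems.AntelopeDictionary
import HarnessLib

/-!
# DepthCutCells — decomp-res node «AntelopeCut» (lens-4 g27, critic row 157), tree file 4/5 of the node

Content VERBATIM from the decomp-res lens-4 g27 node `HOME/decomp-res-lens-4/g27/AntelopeCut.lean` (pin de2834f0 =
`parts/AntelopeCut-g27-de2834f0.lean`,
1 885 l; HOME = run/shared/lean/pub/decomp-res): its NEW PART ONLY, §71–§73 = `parts/part_new-g27-7bf105d9.lean` (40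
declarations) — the carried block
l. 106–1279 (= g26/CompanionCut.lean ll. 85–1258 VERBATIM, machine diff empty) is ALREADY in the tree as
`Theorems/CompanionAlgebra` · `CompanionHasse` ·
`CompanionPresentation` · `CompanionTransport` · `CompanionTowers` · `CompanionCutCells` ·
`MaxContactCutCompanionCut` and is imported, not repeated.
Critic: CRITIC-LEDGER row 157 (2026-08-31T00:29:39Z): DECIDED 0 · MAP 0 — BOOKED («true kernel bricks — land as
support»; the depth / height /
dimension-count axis was priced once at row 151).  Landing orders INBOX :558/:560 (lens-4 g27 landing note +
erratum, split per NEXT-g28 §4) and :566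
(critic): `--kind proof --supports stmt-ResolutionOfSingularities-28338`, namespace `…Theorems.HugValuationCut`,
canonical headers; files of the node:
`DepthLawAlgebra` · `DepthLaw` (§71 + §71b) · `AntelopeDictionary` (§72) · `DepthCutCells` (§73, cone-free cells) ·
`MaxContactCutDepthCut` (the four §73 corollaries GIVEN
31571 `MaxContactCut.NoContactHuggingTowers` BY NAME — in the Theses cone).  Aside bookkeeping (row 157 / INBOX
:566): ONE successor aside on the lens-4
column, `NoWildShallowCompanionKangarooTowers` (home `DepthCutCells`), SUPERSEDING g26's
`NoWildCompanionKangarooTowers` / g25's route aside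
`HCNoWildKangarooOffDoublePointTowers` (exact hyp-free `noWildCompanionKangarooTowers_iff_g27`); the decided cell
`NoWildDeepCompanionKangarooTowers` is a
THEOREM (`noWildDeepCompanionKangarooTowers_holds`) and is not filed; `HeightLaw.no_doublePointTower` stays.

## This file

§73 (cells, EXACT, the g27 step HYPOTHESIS-FREE) — `section DepthCells` minus the four corollaries GIVEN 31571 by
name (those are the wiring file `MaxContactCutDepthCut`): `WildDeepCompanionKangarooTowersTerminate` /
`WildShallowCompanionKangarooTowersTerminate`, `noTowerWild_split_deep`, **`noTowerWild_deep_holds`** (`NoTowerWild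
n (A ∧ DeepTower n)` for EVERY class — the decided cell is a THEOREM), `wildDeepCompanionKangaroo_holds`,
`wildCompanionKangaroo_split`, `wildCompanionKangaroo_iff_g27`, `wildShallowCompanionKangaroo_of_g26`, the cells
`NoWildDeepCompanionKangarooTowers` (DECIDED: `noWildDeepCompanionKangarooTowers_holds`) and
**`NoWildShallowCompanionKangarooTowers`** (THE LOCATED RESIDUAL — the ONE successor aside on the lens-4 column,
superseding g26's `NoWildCompanionKangarooTowers`), the EXACT hypothesis-free re-location
`noWildCompanionKangarooTowers_iff_g27` / `_iff_deep_and_shallow`, the up-links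
`noWildShallowCompanionKangarooTowers_of_g26` / `_of_aside`, `noTowerWild_doublePoint_of_deep`.  Cone-free
(importable by the route file: aside home).  Imports `CompanionCutCells` (g26 cells) + `AntelopeDictionary` (hence `DepthLaw`).

[WRITER NOTE (decomp-res writer g9): file split only (tree files ≤ 400 lines); namespace, universe, sections,
section variables and every declaration
exactly as in the lens (the node's global `set_option` and the `open …Theses` line live only in the wiring file).]

(Sources: Hauser2010Kangaroo (arXiv:0811.4151 §C); Moh1987; HauserPerlega2019 §1; Hauser2024 PRIMS 60 pp. 788, 798;
Cossart2011 III.2 (doi:10.4310/ajm.2011.v15.n3.a3); CossartPiltant2008 §2; CossartPiltant2019 Prop. 2.50;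
Giraud1975; Hironaka1970Additive.)
-/

noncomputable section

open CategoryTheory AlgebraicGeometry IsLocalRing
open Literature.AlgebraicGeometry.Resolution
open Summit.ResolutionOfSingularities.ResolutionOfSingularities.Theorems
open WeakOrderReduction ForcedTowerClasses DivergentTowerClasses MonomialTowerClasses
open HugDimensionClasses HugDimensionKernels SurfaceShadowClasses SurfaceShadowKernels
open NearPointCut (SingularClass)
open AbsoluteContactClasses (IsAbsContactAt SepResidueAt diffIdeal_restrict_le stalkMap_comp_toStalk_eq_stalkHom)
open scoped BigOperators

namespace Summit.ResolutionOfSingularities.ResolutionOfSingularities.Theorems.HugValuationCut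

section DepthCells

/-! ## §73 (g27 · NEW) THE CUT OF THE g26 LOCATED RESIDUAL BY THE DEPTH LAWS — cells and EXACT re-locations BY NAME

`WildCompanionKangarooTowersTerminate n` (g26's located residual: wild, off-locus singular class, `p`-power form at every marked
point, weight-`n` kangaroo-recurrent, off g25's double-point/dim-4 cell, companion-recurrent in every weight) ⟺
(DEEP bed — DECIDED, EMPTY by the depth laws in kernel: `wildDeepCompanionKangaroo_holds`) ∧ (SHALLOW bed — THE LOCATED RESIDUAL
after g27: in addition, EVERY principal weak-contact presentation at EVERY stage `j` has depth `≤ 2n − 1` when `x_{j+1}` is a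
threefold point and `≤ 2n − 2` when it is a fourfold point; g25's clause `¬(n = 2 ∧ DoublePointTower)` is ABSORBED —
`deepTower_of_doublePointTower`).  The re-location `wildCompanionKangaroo_iff_g27` is HYPOTHESIS-FREE. -/

/-- **CELL (g26 residual ∧ DEEP)** — DECIDED: EMPTY by the depth laws (`no_deepTower`); ENTRANCE inhabited by every principal
`p`-power germ of depth `≥ 2p` at a threefold/fourfold point, e.g. `z^p + u₁^{2p+1} + u₂^{3p+1} + u₃^{4p+1} ⊂ 𝔸⁴_k`,
`char k = p`,
any `p` (isolated point of `Sing(f, p)`, clean, depth `2p + 1`): by LAW A its blow-up has the whole plane `E ∩ V(z') ≅ 𝔸²` in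
`Sing(f', p)` — no isolated successor, no forced tower through it; and by the dim-4-only profiles of depth exactly `2p − 1`
(`p = 3`: `z³ + u₁⁵ + u₂⁷ + u₃^{10}`), stopped by LAW B. -/
def WildDeepCompanionKangarooTowersTerminate (n : ℕ) : Prop :=
  NoTowerWild n fun T =>
    (((((SingularClass T ∧ Nonempty (MarkedShadow T n)) ∧ PPowerTower n T) ∧ ¬ EventuallyJumpFree n T) ∧
      ¬ (n = 2 ∧ DoublePointTower T)) ∧ ¬ EventuallyCompanionJumpFree n T) ∧ DeepTower n T

/-- **CELL (g26 residual ∧ SHALLOW) · THE LOCATED RESIDUAL after g27** — UNDECIDED · IDEA-NEEDED: wild, off-locus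
singular class,
`p`-power form at every marked point, weight-`n` kangaroo-recurrent, companion-recurrent in every weight, and
SHALLOW: no stage is
a principal weak-contact point of depth `≥ 2n` before a threefold point or `≥ 2n − 1` before a fourfold point (`|r| + shade ≤
2n − 1`, resp. `≤ 2n − 2`, in EVERY presentation at EVERY stage) — hence (§72) NO ANTELOPE STAGE: the shade of every principal
weight-`p` contact is non-increasing along the tower.  Census profile: ALL 51 recurrent `(2,4)` chains and all 382 `(2,2)` kangO
chains (ring dimension 3: LAW B void; recurrence + LAW A ⇒ depth `≤ 7`, resp. `≤ 3`, at every stage), in particular the six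
`ℓ⁴`-stage chains; and g25's delimiter `z³ + u₁u₂³ + u₁u₂u₃² + u₁⁷ + u₂⁷ + u₃⁷` (`p = 3`, depth `4 = 2p − 2`, isolated dim-4
successor) at the residual's ENTRANCE. -/
def WildShallowCompanionKangarooTowersTerminate (n : ℕ) : Prop :=
  NoTowerWild n fun T =>
    ((((SingularClass T ∧ Nonempty (MarkedShadow T n)) ∧ PPowerTower n T) ∧ ¬ EventuallyJumpFree n T) ∧
      ¬ EventuallyCompanionJumpFree n T) ∧ ¬ DeepTower n T

/-- **KERNEL (pure logic): every class splits EXACTLY by `DeepTower n`.** [folklore] -/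
theorem noTowerWild_split_deep {n : ℕ} (P : ForcedTower → Prop) :
    NoTowerWild n P ↔ NoTowerWild n (fun T => P T ∧ DeepTower n T) ∧ NoTowerWild n (fun T => P T ∧ ¬ DeepTower n T) :=
  noTowerWild_split _ _

/-- **KERNEL (PROVED, no port, every class): THE DEEP COLUMN OF EVERY WILD CLASS IS EMPTY** — the general form of the cut,
applicable verbatim to every other lens's tower residual (`p ∣ n`, `p` prime ⇒ `n ≥ 2`; `no_deepTower`). [folklore] -/
theorem noTowerWild_deep_holds {n : ℕ} (hn : 1 ≤ n) (P : ForcedTower → Prop) :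
    NoTowerWild n fun T => P T ∧ DeepTower n T := by
  intro p hp hpn k _ _ T g hB hD _ hT
  have hn2 : 2 ≤ n := le_trans hp.two_le (Nat.le_of_dvd (by omega) hpn)
  exact no_deepTower T g hB hD hn2 hT.2

/-- **DECIDED (KERNEL, PROVED, every `n`, every field): THE DEEP CELL IS EMPTY.** [folklore] -/
theorem wildDeepCompanionKangaroo_holds {n : ℕ} (hn : 1 ≤ n) : WildDeepCompanionKangarooTowersTerminate n :=
  noTowerWild_deep_holds hn fun T =>
    ((((SingularClass T ∧ Nonempty (MarkedShadow T n)) ∧ PPowerTower n T) ∧ ¬ EventuallyJumpFree n T) ∧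
      ¬ (n = 2 ∧ DoublePointTower T)) ∧ ¬ EventuallyCompanionJumpFree n T

/-- **EXACT (pure logic): the g26 located residual = the deep bed ∧ (g26 residual ∧ shallow).** [folklore] -/
theorem wildCompanionKangaroo_split (n : ℕ) :
    WildCompanionKangarooTowersTerminate n ↔
      WildDeepCompanionKangarooTowersTerminate n ∧
        NoTowerWild n (fun T =>
          (((((SingularClass T ∧ Nonempty (MarkedShadow T n)) ∧ PPowerTower n T) ∧ ¬ EventuallyJumpFree n T) ∧
            ¬ (n = 2 ∧ DoublePointTower T)) ∧ ¬ EventuallyCompanionJumpFree n T) ∧ ¬ DeepTower n T) :=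
  noTowerWild_split _ _

/-- **EXACT RE-LOCATION, HYPOTHESIS-FREE (KERNEL, PROVED): the g26 located residual ⟺ THE SHALLOW RESIDUAL** — the deep bed is
empty by the law, and on the shallow side g25's clause is absorbed (`deepTower_of_doublePointTower`). [folklore] -/
theorem wildCompanionKangaroo_iff_g27 {n : ℕ} (hn : 1 ≤ n) :
    WildCompanionKangarooTowersTerminate n ↔ WildShallowCompanionKangarooTowersTerminate n := by
  constructor
  · intro h p hp hpn k _ _ T g hB hD hb hT
    obtain ⟨⟨hA, hC⟩, hdeep⟩ := hT
    have hndp : ¬ (n = 2 ∧ DoublePointTower T) := by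
      rintro ⟨rfl, hdpt⟩
      exact hdeep (deepTower_of_doublePointTower T hdpt)
    exact h p hp hpn k T g hB hD hb ⟨⟨hA, hndp⟩, hC⟩
  · intro h p hp hpn k _ _ T g hB hD hb hT
    obtain ⟨⟨hA, -⟩, hC⟩ := hT
    by_cases hdeep : DeepTower n T
    · have hn2 : 2 ≤ n := le_trans hp.two_le (Nat.le_of_dvd (by omega) hpn)
      exact no_deepTower T g hB hD hn2 hdeep
    · exact h p hp hpn k T g hB hD hb ⟨⟨hA, hC⟩, hdeep⟩

/-- the shallow residual is a sub-residual of g26's (hypothesis-free). [folklore] -/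
theorem wildShallowCompanionKangaroo_of_g26 {n : ℕ} (hn : 1 ≤ n) (h : WildCompanionKangarooTowersTerminate n) :
    WildShallowCompanionKangarooTowersTerminate n :=
  (wildCompanionKangaroo_iff_g27 hn).mp h

/-- BY NAME: **no wild DEEP companion-recurrent tower** (DECIDED: PROVED). -/
def NoWildDeepCompanionKangarooTowers : Prop := ∀ n : ℕ, 1 ≤ n → WildDeepCompanionKangarooTowersTerminate n

/-- BY NAME: **no wild SHALLOW companion-recurrent tower** — THE LOCATED RESIDUAL of the aside chain
`NoWildContactFreeOffLocusTowers ⊇ NoWildPPowerOffLocusTowers ⊇ NoWildKangarooOffLocusTowers ⊇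
NoWildKangarooOffDoublePointTowers ⊇
NoWildCompanionKangarooTowers ⊇ ·` after g27. -/
def NoWildShallowCompanionKangarooTowers : Prop := ∀ n : ℕ, 1 ≤ n → WildShallowCompanionKangarooTowersTerminate n

/-- **DECIDED BY NAME (KERNEL, PROVED).** [folklore] -/
theorem noWildDeepCompanionKangarooTowers_holds : NoWildDeepCompanionKangarooTowers := fun _ hn =>
  wildDeepCompanionKangaroo_holds hn

/-- **EXACT RE-LOCATION BY NAME, HYPOTHESIS-FREE: the g26 residual ⟺ the shallow residual.** [folklore] -/
theorem noWildCompanionKangarooTowers_iff_g27 : NoWildCompanionKangarooTowers ↔ NoWildShallowCompanionKangarooTowers :=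
  ⟨fun h n hn => (wildCompanionKangaroo_iff_g27 hn).mp (h n hn), fun h n hn => (wildCompanionKangaroo_iff_g27 hn).mpr (h n hn)⟩

/-- **EXACT BY NAME as a conjunction (deep ∧ shallow), hypothesis-free.** [folklore] -/
theorem noWildCompanionKangarooTowers_iff_deep_and_shallow :
    NoWildCompanionKangarooTowers ↔ NoWildDeepCompanionKangarooTowers ∧ NoWildShallowCompanionKangarooTowers :=
  ⟨fun h => ⟨noWildDeepCompanionKangarooTowers_holds, noWildCompanionKangarooTowers_iff_g27.mp h⟩,
    fun h => noWildCompanionKangarooTowers_iff_g27.mpr h.2⟩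

/-- up-link (hypothesis-free direction): the g27 residual ⟸ the g26 residual ⟸ g25's ⟸ g24's ⟸ g23's ⟸ the tree
aside. [folklore] -/
theorem noWildShallowCompanionKangarooTowers_of_g26 (h : NoWildCompanionKangarooTowers) :
    NoWildShallowCompanionKangarooTowers :=
  noWildCompanionKangarooTowers_iff_g27.mp h

/-- up-link from the TREE aside `NoWildContactFreeOffLocusTowers` (hypothesis-free). [folklore] -/
theorem noWildShallowCompanionKangarooTowers_of_aside (h : NoWildContactFreeOffLocusTowers) :
    NoWildShallowCompanionKangarooTowers :=
  noWildShallowCompanionKangarooTowers_of_g26 (noWildCompanionKangarooTowers_of_aside h)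

/-- **THE g25 DECIDED CELL LIES IN THE g27 DECIDED CELL, class level (KERNEL, pure logic)**: for any class `A`,
`NoTowerWild 2 (A ∧ DeepTower 2) → NoTowerWild 2 (A ∧ DoublePointTower)`. [folklore] -/
theorem noTowerWild_doublePoint_of_deep (A : ForcedTower → Prop)
    (h : NoTowerWild 2 fun T => A T ∧ DeepTower 2 T) : NoTowerWild 2 fun T => A T ∧ DoublePointTower T :=
  noTowerWild_mono (fun T hT => ⟨hT.1, deepTower_of_doublePointTower T hT.2⟩) h

end DepthCells

end Summit.ResolutionOfSingularities.ResolutionOfSingularities.Theorems.HugValuationCut
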